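import Summits.CriticalPhenomena.PercolationContinuityZ3.Theorems.Transplant.FKConnectivityAllQTwoTree
import HarnessLib

/-!
# Connectivity correlation inequalities for `φ_{w,q}`, every `q > 0` — DUALITY TRANSPORT of edge-negative association
# (Potts–Rayleigh supports are closed under abstract / planar duality)

Support file (`--supports stmt-CriticalPhenomena-4575`), FK sub-lane `prim-bschramm-fk-3` (gen 19) of the post-continuity programme;
builds on p205010 (kernel theorem, internal audit signed; external expert review pending).  No definitions, no named facts, no sorries.

Two injective listings `e : Fin m → Sym2 V`, `e' : Fin m → Sym2 V'` of `m` pairs on finite vertex types are ABSTRACTLY DUAL with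
constant `c` when `k_V(e '' t) + |t| = k_{V'}(e' '' tᶜ) + c` for every index set `t` (`hk`) — for a connected plane graph and its
geometric dual this is Euler's formula `k(ω) = |V| − |η(ω)| + f(ω) − 1` with `f(ω_d) = k(ω)` (Grimmett 2006, §6.1 (6.1)–(6.2)),
`c = |V| − 1` up to idle vertices.  Under `hk`, with the dual weights `w'(e' i)/(1 − w'(e' i)) = q(1 − w(e i))/w(e i)` ((6.5), edge
by edge for the edge-parameter measure (1.20)), `t ↦ tᶜ` carries `φ_{w,q}` to `φ_{w',q}` up to a constant (`rcWeightW_dual` = (6.4)/(6.6)),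
an open pair to a CLOSED dual pair; the covariance of two indicators is the covariance of their complements, so NEGATIVE CORRELATION OF
A PAIR OF EDGES TRANSFERS ACROSS THE DUALITY (`negCorr_dual`), whence the support-level statement of the `q < 1` programme:
* **`FK.Dual.edgeNegCorrSupp_of_dual`** (`0 < q`): `e, e'` abstractly dual, `e'` loop-free ⟹ `EdgeNegCorrSupp (range e') q →
  EdgeNegCorrSupp (range e) q` — the graph case of "Potts–Rayleigh matroids are closed under duality" (Wagner 2008, Thm. 5.8) in the
  tree's vocabulary; `hk` is a finite identity that `decide` settles on listed graphs via fk-1 g17's `RCEval.kOf_eq_clusterCount`.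
Also here: the listed-sum evaluation of `φ_{w,q}` for ARBITRARY real weights supported on an injective listing (`real_eq_div`).
First user: the triangular prism `K₃ □ K₂ = (K₅⁻)*` (sibling file `…AllQPrism.lean`).
[cite: Grimmett2006, §6.1 eq. (6.1)–(6.6), (6.10) (pp. 133–134); §1.4 eq. (1.20) (p. 15); §3.9 eq. (3.94) (p. 63)]
[cite: Wagner2006, Thm. 5.8, §5.3 (pp. 14–15)]
-/
noncomputable section

namespace Summit.CriticalPhenomena.PercolationContinuityZ3.Theorems

namespace FK

namespace Dual

open MeasureTheory Literature.Probability.LatticeModels Literature.Probability.Percolation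
open Literature.Probability.Percolation.BHK2006 (weight)
open Literature.Probability.Percolation.DecisionTree (ind ind_of_mem ind_of_not_mem)
open scoped Classical

variable {V : Type*} {m : ℕ} {e : Fin m → Sym2 V}

/-! ### Listed configurations `e '' t` and the listed-sum evaluation of `φ_{w,q}` -/

/-- Membership of a listed pair in the listed configuration `e '' t`. [folklore] -/
theorem mem_image_iff (he : Function.Injective e) (t : Finset (Fin m)) (i : Fin m) :
    e i ∈ ((↑(t.image e) : BondConfig V)) ↔ i ∈ t := by
  rw [Finset.mem_coe, Finset.mem_image]
  exact ⟨fun ⟨j, hj, hji⟩ => he hji ▸ hj, fun h => ⟨i, h, rfl⟩⟩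

/-- A listed configuration uses listed pairs only. [folklore] -/
theorem image_subset_range (t : Finset (Fin m)) : ((↑(t.image e) : BondConfig V)) ⊆ Set.range e := fun f hf => by
  obtain ⟨i, _, rfl⟩ := Finset.mem_image.1 (Finset.mem_coe.1 hf)
  exact ⟨i, rfl⟩

/-- A configuration made of listed pairs is a listed configuration. [folklore] -/
theorem exists_image_eq (ω : BondConfig V) (hω : ω ⊆ Set.range e) :
    ∃ t : Finset (Fin m), ((↑(t.image e) : BondConfig V)) = ω := by
  refine ⟨Finset.univ.filter fun i => e i ∈ ω, Set.ext fun f => ?_⟩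
  rw [Finset.mem_coe, Finset.mem_image]
  refine ⟨fun ⟨i, hi, hf⟩ => hf ▸ (Finset.mem_filter.1 hi).2, fun hf => ?_⟩
  obtain ⟨i, rfl⟩ := hω hf
  exact ⟨i, Finset.mem_filter.2 ⟨Finset.mem_univ _, hf⟩, rfl⟩

/-- Listing configurations is injective for an injective listing. [folklore] -/
theorem image_injective (he : Function.Injective e) :
    Function.Injective fun t : Finset (Fin m) => ((↑(t.image e) : BondConfig V)) := by
  intro s t h
  ext i
  rw [← mem_image_iff he s i, ← mem_image_iff he t i, show ((↑(s.image e) : BondConfig V)) = ↑(t.image e) from h]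

variable [Fintype V]

/-- **The product weight of a listed configuration** for a weight vector supported on the listing:
`∏_i (w(e i) if i ∈ t else 1 − w(e i))`. [cite: Grimmett2006, §1.4 eq. (1.20) (p. 15)] -/
theorem weight_image (he : Function.Injective e) {w : Sym2 V → unitInterval}
    (hw : ∀ f, ((w f : unitInterval) : ℝ) ≠ 0 → f ∈ Set.range e) (t : Finset (Fin m)) :
    weight (fun f => (w f : ℝ)) ((↑(t.image e) : BondConfig V)) =
      ∏ i, (if i ∈ t then ((w (e i) : unitInterval) : ℝ) else 1 - w (e i)) := by
  unfold weight
  rw [← Finset.prod_subset (Finset.subset_univ (Finset.univ.image e))]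
  · rw [Finset.prod_image fun i _ j _ h => he h]
    refine Finset.prod_congr rfl fun i _ => ?_
    by_cases hi : i ∈ t
    · rw [if_pos ((mem_image_iff he t i).2 hi), if_pos hi]
    · rw [if_neg (fun h => hi ((mem_image_iff he t i).1 h)), if_neg hi]
  · intro f _ hf
    have hf' : f ∉ Set.range e := by
      rintro ⟨i, rfl⟩
      exact hf (Finset.mem_image.2 ⟨i, Finset.mem_univ _, rfl⟩)
    have hw0 : ((w f : unitInterval) : ℝ) = 0 := not_not.1 fun h => hf' (hw f h)
    dsimp only
    rw [if_neg (fun h => hf' (image_subset_range t h)), hw0, sub_zero]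

/-- A configuration using an unlisted pair (weight `0`) has random-cluster weight `0`. [cite: Grimmett2006, §1.4 eq. (1.20) (p. 15)] -/
theorem rcWeightW_eq_zero_of_not_subset {w : Sym2 V → unitInterval} (hw : ∀ f, ((w f : unitInterval) : ℝ) ≠ 0 → f ∈ Set.range e)
    {ω : BondConfig V} (hω : ¬ ω ⊆ Set.range e) (q : ℝ) : rcWeightW w q ∅ ω = 0 := by
  obtain ⟨f, hfω, hf⟩ := Set.not_subset.1 hω
  have hw0 : ((w f : unitInterval) : ℝ) = 0 := not_not.1 fun h => hf (hw f h)
  unfold rcWeightW weight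
  rw [Finset.prod_eq_zero (Finset.mem_univ f) (by dsimp only; rw [if_pos hfω, hw0]), zero_mul]

/-- **Transfer to listed sums**: a weighted sum over all configurations is the listed sum. [cite: Grimmett2006, §1.4 eq. (1.20) (p. 15)] -/
theorem sum_rcWeightW_mul (he : Function.Injective e) {w : Sym2 V → unitInterval}
    (hw : ∀ f, ((w f : unitInterval) : ℝ) ≠ 0 → f ∈ Set.range e) (q : ℝ) (g : BondConfig V → ℝ) :
    ∑ ω : BondConfig V, rcWeightW w q ∅ ω * g ω =
      ∑ t : Finset (Fin m), rcWeightW w q ∅ (↑(t.image e)) * g (↑(t.image e)) := by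
  rw [← Finset.sum_subset (Finset.subset_univ (Finset.univ.image fun t : Finset (Fin m) => ((↑(t.image e) : BondConfig V))))]
  · rw [Finset.sum_image fun s _ t _ h => image_injective he h]
  · intro ω _ hω
    have hω' : ¬ ω ⊆ Set.range e := by
      intro h
      obtain ⟨t, rfl⟩ := exists_image_eq ω h
      exact hω (Finset.mem_image.2 ⟨t, Finset.mem_univ _, rfl⟩)
    rw [rcWeightW_eq_zero_of_not_subset hw hω', zero_mul]

/-- **Listed-sum evaluation of `φ_{w,q}`** (`0 < q`, `w` supported on the injective listing `e`):
`φ_{w,q}(X) = (∑_t W(e '' t)·1_X(e '' t)) / ∑_t W(e '' t)`. [cite: Grimmett2006, §1.4 eq. (1.20) (p. 15)] -/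
theorem real_eq_div (he : Function.Injective e) {w : Sym2 V → unitInterval}
    (hw : ∀ f, ((w f : unitInterval) : ℝ) ≠ 0 → f ∈ Set.range e) {q : ℝ} (hq : 0 < q) (X : Set (BondConfig V)) :
    (rcMeasureW w q ∅).real X =
      (∑ t : Finset (Fin m), rcWeightW w q ∅ (↑(t.image e)) * ind X (↑(t.image e))) /
        ∑ t : Finset (Fin m), rcWeightW w q ∅ (↑(t.image e)) := by
  rw [rcMeasureW_real_eq_sum_div w hq ∅ X, sum_rcWeightW_mul he hw q (ind X)]
  have h := sum_rcWeightW_mul he hw q (fun _ => (1 : ℝ))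
  simp only [mul_one] at h
  rw [rcPartitionFunctionW, h]

/-- The listed partition function is positive (`0 < q`). [cite: Grimmett2006, §1.4 eq. (1.20) (p. 15)] -/
theorem sum_rcWeightW_pos (he : Function.Injective e) {w : Sym2 V → unitInterval}
    (hw : ∀ f, ((w f : unitInterval) : ℝ) ≠ 0 → f ∈ Set.range e) {q : ℝ} (hq : 0 < q) :
    0 < ∑ t : Finset (Fin m), rcWeightW w q ∅ (↑(t.image e)) := by
  have h := sum_rcWeightW_mul he hw q (fun _ => (1 : ℝ))
  simp only [mul_one] at h
  exact h ▸ rcPartitionFunctionW_pos w hq ∅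

omit [Fintype V] in
/-- The listed sum against the indicator of `J_{e i} = {e i open}` is the sum over `t ∋ i`. [cite: Grimmett2006, §1.4 eq. (1.20) (p. 15)] -/
theorem sum_ind_openPair (he : Function.Injective e) (W : BondConfig V → ℝ) (i : Fin m) :
    ∑ t : Finset (Fin m), W (↑(t.image e)) * ind {ω : BondConfig V | e i ∈ ω} (↑(t.image e)) =
      ∑ t : Finset (Fin m), W (↑(t.image e)) * (if i ∈ t then 1 else 0) := by
  refine Finset.sum_congr rfl fun t _ => ?_
  by_cases hi : i ∈ t
  · rw [if_pos hi, ind_of_mem (show ((↑(t.image e) : BondConfig V)) ∈ {ω : BondConfig V | e i ∈ ω} from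
      (mem_image_iff he t i).2 hi)]
  · rw [if_neg hi, ind_of_not_mem (show ((↑(t.image e) : BondConfig V)) ∉ {ω : BondConfig V | e i ∈ ω} from
      fun h => hi ((mem_image_iff he t i).1 h))]

omit [Fintype V] in
/-- The listed sum against the indicator of `J_{e i} ∩ J_{e j}` is the sum over `t ∋ i, j`. [cite: Grimmett2006, §1.4 eq. (1.20) (p. 15)] -/
theorem sum_ind_openPair_inter (he : Function.Injective e) (W : BondConfig V → ℝ) (i j : Fin m) :
    ∑ t : Finset (Fin m), W (↑(t.image e)) * ind ({ω : BondConfig V | e i ∈ ω} ∩ {ω | e j ∈ ω}) (↑(t.image e)) =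
      ∑ t : Finset (Fin m), W (↑(t.image e)) * (if i ∈ t ∧ j ∈ t then 1 else 0) := by
  refine Finset.sum_congr rfl fun t _ => ?_
  by_cases hi : i ∈ t ∧ j ∈ t
  · rw [if_pos hi, ind_of_mem (show ((↑(t.image e) : BondConfig V)) ∈ {ω : BondConfig V | e i ∈ ω} ∩ {ω | e j ∈ ω} from
      ⟨(mem_image_iff he t i).2 hi.1, (mem_image_iff he t j).2 hi.2⟩)]
  · rw [if_neg hi, ind_of_not_mem (show ((↑(t.image e) : BondConfig V)) ∉ {ω : BondConfig V | e i ∈ ω} ∩ {ω | e j ∈ ω} from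
      fun h => hi ⟨(mem_image_iff he t i).1 h.1, (mem_image_iff he t j).1 h.2⟩)]

variable {V' : Type*} [Fintype V'] {e' : Fin m → Sym2 V'} {w : Sym2 V → unitInterval} {w' : Sym2 V' → unitInterval}
  {q : ℝ} {c : ℕ}

omit [Fintype V] in
/-- The dual normaliser `w(e i) + q(1 − w(e i))` is positive for `0 < q`. [cite: Grimmett2006, §6.1 eq. (6.5) (p. 134)] -/
theorem dualDen_pos (hq : 0 < q) (i : Fin m) : 0 < ((w (e i) : unitInterval) : ℝ) + q * (1 - w (e i)) := by
  have h1 : ((w (e i) : unitInterval) : ℝ) ≤ 1 := (w (e i)).2.2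
  by_cases hp : ((w (e i) : unitInterval) : ℝ) = 0
  · rw [hp]; linarith
  · nlinarith [lt_of_le_of_ne (w (e i)).2.1 (Ne.symm hp)]

omit [Fintype V] [Fintype V'] in
/-- **The product weights under duality**: with `w'(e' i)·(w(e i) + q(1 − w(e i))) = q(1 − w(e i))` for every `i`,
`(∏_i (w(e i) + q(1 − w(e i)))) · ∏_i (w' if i ∈ tᶜ else 1 − w') = q^{|tᶜ|} · ∏_i (w if i ∈ t else 1 − w)`.
[cite: Grimmett2006, §6.1 eq. (6.4)–(6.5) (p. 134)] -/
theorem prod_dual (hdual : ∀ i, ((w' (e' i) : unitInterval) : ℝ) * (((w (e i) : unitInterval) : ℝ) + q * (1 - w (e i))) =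
      q * (1 - w (e i))) (t : Finset (Fin m)) :
    (∏ i, (((w (e i) : unitInterval) : ℝ) + q * (1 - w (e i)))) *
        ∏ i, (if i ∈ tᶜ then ((w' (e' i) : unitInterval) : ℝ) else 1 - w' (e' i)) =
      q ^ tᶜ.card * ∏ i, (if i ∈ t then ((w (e i) : unitInterval) : ℝ) else 1 - w (e i)) := by
  rw [← Finset.prod_mul_distrib]
  have hterm : ∀ i, (((w (e i) : unitInterval) : ℝ) + q * (1 - w (e i))) *
      (if i ∈ tᶜ then ((w' (e' i) : unitInterval) : ℝ) else 1 - w' (e' i)) =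
      (if i ∈ t then (1 : ℝ) else q) * (if i ∈ t then ((w (e i) : unitInterval) : ℝ) else 1 - w (e i)) := by
    intro i
    have hD := hdual i
    by_cases hi : i ∈ t
    · rw [if_neg (fun h => (Finset.mem_compl.1 h) hi), if_pos hi, if_pos hi, one_mul]
      linear_combination (-1 : ℝ) * hD
    · rw [if_pos (Finset.mem_compl.2 hi), if_neg hi, if_neg hi]
      linear_combination hD
  simp_rw [hterm]
  rw [Finset.prod_mul_distrib]
  congr 1
  rw [← Finset.prod_mul_prod_compl t]
  rw [Finset.prod_congr rfl (fun i (hi : i ∈ t) => if_pos hi), Finset.prod_congr rfl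
    (fun i (hi : i ∈ tᶜ) => if_neg (Finset.mem_compl.1 hi)), Finset.prod_const_one, one_mul, Finset.prod_const]

/-- **The random-cluster weights under duality**: if the listings are abstractly dual with constant `c` (`hk`) and the weights
are dual edge by edge (`hdual`), then `(∏_i (w(e i) + q(1 − w(e i)))) · q^c · W'(e' '' tᶜ) = q^m · W(e '' t)` — Grimmett's
`φ_{G,p,q}(ω) ∝ φ_{G_d,p_d,q}(ω_d)` (6.4), edge-parameter form. [cite: Grimmett2006, §6.1 eq. (6.1)–(6.6), (6.10) (pp. 133–134)] -/
theorem rcWeightW_dual (he : Function.Injective e) (he' : Function.Injective e')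
    (hw : ∀ f, ((w f : unitInterval) : ℝ) ≠ 0 → f ∈ Set.range e) (hw' : ∀ f, ((w' f : unitInterval) : ℝ) ≠ 0 → f ∈ Set.range e')
    (hdual : ∀ i, ((w' (e' i) : unitInterval) : ℝ) * (((w (e i) : unitInterval) : ℝ) + q * (1 - w (e i))) = q * (1 - w (e i)))
    (hk : ∀ t : Finset (Fin m), clusterCount ((↑(t.image e) : BondConfig V)) ∅ + t.card =
      clusterCount ((↑(tᶜ.image e') : BondConfig V')) ∅ + c)
    (t : Finset (Fin m)) :
    (∏ i, (((w (e i) : unitInterval) : ℝ) + q * (1 - w (e i)))) * q ^ c * rcWeightW w' q ∅ (↑(tᶜ.image e')) =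
      q ^ m * rcWeightW w q ∅ (↑(t.image e)) := by
  unfold rcWeightW
  rw [weight_image he hw t, weight_image he' hw' tᶜ]
  have hkt := hk t
  have hm : t.card + tᶜ.card = m := by rw [Finset.card_add_card_compl, Fintype.card_fin]
  set PD := ∏ i, (((w (e i) : unitInterval) : ℝ) + q * (1 - w (e i)))
  set P := ∏ i, (if i ∈ t then ((w (e i) : unitInterval) : ℝ) else 1 - w (e i))
  set P' := ∏ i, (if i ∈ tᶜ then ((w' (e' i) : unitInterval) : ℝ) else 1 - w' (e' i))
  set k := clusterCount ((↑(t.image e) : BondConfig V)) ∅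
  set k' := clusterCount ((↑(tᶜ.image e') : BondConfig V')) ∅
  have hpow : q ^ c * q ^ k' = q ^ k * q ^ t.card := by
    rw [← pow_add, ← pow_add, show c + k' = k + t.card by omega]
  calc PD * q ^ c * (P' * q ^ k') = (PD * P') * (q ^ c * q ^ k') := by ring
    _ = (q ^ tᶜ.card * P) * (q ^ k * q ^ t.card) := by rw [prod_dual hdual t, hpow]
    _ = (q ^ tᶜ.card * q ^ t.card) * (P * q ^ k) := by ring
    _ = q ^ m * (P * q ^ k) := by rw [← pow_add, show tᶜ.card + t.card = m by omega]

/-- **Listed sums under duality**: for indicator-type functions related by `g' tᶜ = g t`,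
`(∏D)·q^c · ∑_s W'(e' '' s) g'(s) = q^m · ∑_t W(e '' t) g(t)` (reindex `s = tᶜ`).
[cite: Grimmett2006, §6.1 eq. (6.6), (6.10) (p. 134)] -/
theorem sum_dual (he : Function.Injective e) (he' : Function.Injective e')
    (hw : ∀ f, ((w f : unitInterval) : ℝ) ≠ 0 → f ∈ Set.range e) (hw' : ∀ f, ((w' f : unitInterval) : ℝ) ≠ 0 → f ∈ Set.range e')
    (hdual : ∀ i, ((w' (e' i) : unitInterval) : ℝ) * (((w (e i) : unitInterval) : ℝ) + q * (1 - w (e i))) = q * (1 - w (e i)))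
    (hk : ∀ t : Finset (Fin m), clusterCount ((↑(t.image e) : BondConfig V)) ∅ + t.card =
      clusterCount ((↑(tᶜ.image e') : BondConfig V')) ∅ + c)
    (g g' : Finset (Fin m) → ℝ) (hgg' : ∀ t, g' tᶜ = g t) :
    (∏ i, (((w (e i) : unitInterval) : ℝ) + q * (1 - w (e i)))) * q ^ c *
        ∑ s : Finset (Fin m), rcWeightW w' q ∅ (↑(s.image e')) * g' s =
      q ^ m * ∑ t : Finset (Fin m), rcWeightW w q ∅ (↑(t.image e)) * g t := by
  rw [Fintype.sum_bijective (fun t : Finset (Fin m) => tᶜ) compl_bijective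
    (fun t => rcWeightW w' q ∅ (↑(tᶜ.image e')) * g' tᶜ) (fun s => rcWeightW w' q ∅ (↑(s.image e')) * g' s) (fun _ => rfl)
    |>.symm, Finset.mul_sum, Finset.mul_sum]
  refine Finset.sum_congr rfl fun t _ => ?_
  rw [hgg' t, ← mul_assoc, rcWeightW_dual he he' hw hw' hdual hk t, mul_assoc]

/-- **Negative correlation of a pair of edges transfers across the duality** (`0 < q`): if the dual pairs `e' i, e' j` are
negatively correlated under `φ_{w',q}`, then `e i, e j` are negatively correlated under `φ_{w,q}` — the covariance of two
indicators equals the covariance of their complements, and open ↔ dual-closed.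
[cite: Grimmett2006, §6.1 eq. (6.6) (p. 134); §3.9 eq. (3.94) (p. 63)] [cite: Wagner2006, Thm. 5.8 (p. 14)] -/
theorem negCorr_dual (he : Function.Injective e) (he' : Function.Injective e')
    (hw : ∀ f, ((w f : unitInterval) : ℝ) ≠ 0 → f ∈ Set.range e) (hw' : ∀ f, ((w' f : unitInterval) : ℝ) ≠ 0 → f ∈ Set.range e')
    (hq : 0 < q)
    (hdual : ∀ i, ((w' (e' i) : unitInterval) : ℝ) * (((w (e i) : unitInterval) : ℝ) + q * (1 - w (e i))) = q * (1 - w (e i)))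
    (hk : ∀ t : Finset (Fin m), clusterCount ((↑(t.image e) : BondConfig V)) ∅ + t.card =
      clusterCount ((↑(tᶜ.image e') : BondConfig V')) ∅ + c)
    (i j : Fin m)
    (hNC' : (rcMeasureW w' q ∅).real ({ω : BondConfig V' | e' i ∈ ω} ∩ {ω | e' j ∈ ω}) ≤
      (rcMeasureW w' q ∅).real {ω : BondConfig V' | e' i ∈ ω} * (rcMeasureW w' q ∅).real {ω : BondConfig V' | e' j ∈ ω}) :
    (rcMeasureW w q ∅).real ({ω : BondConfig V | e i ∈ ω} ∩ {ω | e j ∈ ω}) ≤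
      (rcMeasureW w q ∅).real {ω : BondConfig V | e i ∈ ω} * (rcMeasureW w q ∅).real {ω : BondConfig V | e j ∈ ω} := by
  -- listed-sum form of all six probabilities
  rw [real_eq_div he hw hq, real_eq_div he hw hq, real_eq_div he hw hq, sum_ind_openPair_inter he, sum_ind_openPair he,
    sum_ind_openPair he]
  rw [real_eq_div he' hw' hq, real_eq_div he' hw' hq, real_eq_div he' hw' hq, sum_ind_openPair_inter he', sum_ind_openPair he',
    sum_ind_openPair he'] at hNC'
  set K := (∏ i, (((w (e i) : unitInterval) : ℝ) + q * (1 - w (e i)))) * q ^ c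
  -- the dual sums: Z' ↔ Z, A' ↔ Z − A (one pair), AB' ↔ Z − A − B + AB (two pairs)
  have hZZ : K * ∑ t : Finset (Fin m), rcWeightW w' q ∅ (↑(t.image e')) = q ^ m * ∑ t : Finset (Fin m), rcWeightW w q ∅ (↑(t.image e)) := by
    simpa only [mul_one] using sum_dual he he' hw hw' hdual hk (fun _ => (1 : ℝ)) (fun _ => (1 : ℝ)) (fun _ => rfl)
  have hone : ∀ k : Fin m, K * (∑ t : Finset (Fin m), rcWeightW w' q ∅ (↑(t.image e')) * (if k ∈ t then 1 else 0)) =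
      q ^ m * (∑ t : Finset (Fin m), rcWeightW w q ∅ (↑(t.image e)) -
        ∑ t : Finset (Fin m), rcWeightW w q ∅ (↑(t.image e)) * (if k ∈ t then 1 else 0)) := by
    intro k
    rw [sum_dual he he' hw hw' hdual hk (fun t => if k ∈ t then (0 : ℝ) else 1) (fun t => if k ∈ t then (1 : ℝ) else 0)
      (fun t => by
        by_cases hk' : k ∈ t
        · rw [if_neg (fun h => (Finset.mem_compl.1 h) hk'), if_pos hk']
        · rw [if_pos (Finset.mem_compl.2 hk'), if_neg hk']), ← Finset.sum_sub_distrib]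
    congr 1
    refine Finset.sum_congr rfl fun t _ => ?_
    split_ifs <;> ring
  have htwo : K * (∑ t : Finset (Fin m), rcWeightW w' q ∅ (↑(t.image e')) * (if i ∈ t ∧ j ∈ t then 1 else 0)) =
      q ^ m * (∑ t : Finset (Fin m), rcWeightW w q ∅ (↑(t.image e)) -
        ∑ t : Finset (Fin m), rcWeightW w q ∅ (↑(t.image e)) * (if i ∈ t then 1 else 0) -
        ∑ t : Finset (Fin m), rcWeightW w q ∅ (↑(t.image e)) * (if j ∈ t then 1 else 0) +
        ∑ t : Finset (Fin m), rcWeightW w q ∅ (↑(t.image e)) * (if i ∈ t ∧ j ∈ t then 1 else 0)) := by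
    rw [sum_dual he he' hw hw' hdual hk (fun t => if i ∉ t ∧ j ∉ t then (1 : ℝ) else 0)
      (fun t => if i ∈ t ∧ j ∈ t then (1 : ℝ) else 0)
      (fun t => by
        by_cases hij : i ∉ t ∧ j ∉ t
        · rw [if_pos hij, if_pos (show i ∈ tᶜ ∧ j ∈ tᶜ from ⟨Finset.mem_compl.2 hij.1, Finset.mem_compl.2 hij.2⟩)]
        · rw [if_neg hij, if_neg (fun h => hij ⟨Finset.mem_compl.1 h.1, Finset.mem_compl.1 h.2⟩)]),
      ← Finset.sum_sub_distrib, ← Finset.sum_sub_distrib, ← Finset.sum_add_distrib]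
    congr 1
    refine Finset.sum_congr rfl fun t _ => ?_
    by_cases hi : i ∈ t <;> by_cases hj : j ∈ t <;> simp [hi, hj]
  have hAA := hone i
  have hBB := hone j
  set Z := ∑ t : Finset (Fin m), rcWeightW w q ∅ (↑(t.image e))
  set A := ∑ t : Finset (Fin m), rcWeightW w q ∅ (↑(t.image e)) * (if i ∈ t then 1 else 0)
  set B := ∑ t : Finset (Fin m), rcWeightW w q ∅ (↑(t.image e)) * (if j ∈ t then 1 else 0)
  set AB := ∑ t : Finset (Fin m), rcWeightW w q ∅ (↑(t.image e)) * (if i ∈ t ∧ j ∈ t then 1 else 0)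
  set Z' := ∑ t : Finset (Fin m), rcWeightW w' q ∅ (↑(t.image e'))
  set A' := ∑ t : Finset (Fin m), rcWeightW w' q ∅ (↑(t.image e')) * (if i ∈ t then 1 else 0)
  set B' := ∑ t : Finset (Fin m), rcWeightW w' q ∅ (↑(t.image e')) * (if j ∈ t then 1 else 0)
  set AB' := ∑ t : Finset (Fin m), rcWeightW w' q ∅ (↑(t.image e')) * (if i ∈ t ∧ j ∈ t then 1 else 0)
  have hKpos : 0 < K := mul_pos (Finset.prod_pos fun i _ => dualDen_pos hq i) (pow_pos hq c)
  have hqm : 0 < q ^ m := pow_pos hq m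
  have hZpos : 0 < Z := sum_rcWeightW_pos he hw hq
  have hZ'pos : 0 < Z' := sum_rcWeightW_pos he' hw' hq
  -- the dual inequality in polynomial form: AB'·Z' ≤ A'·B'
  have hNC'' : AB' * Z' ≤ A' * B' := by
    rw [div_mul_div_comm, div_le_div_iff₀ hZ'pos (mul_pos hZ'pos hZ'pos)] at hNC'
    have h : (AB' * Z') * Z' ≤ (A' * B') * Z' := by linarith [hNC']
    exact le_of_mul_le_mul_right h hZ'pos
  -- multiply by `K²` and translate through the four dual-sum identities
  have hmain : AB * Z ≤ A * B := by
    have h1 : (K * AB') * (K * Z') ≤ (K * A') * (K * B') :=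
      calc (K * AB') * (K * Z') = K * K * (AB' * Z') := by ring
        _ ≤ K * K * (A' * B') := mul_le_mul_of_nonneg_left hNC'' (mul_pos hKpos hKpos).le
        _ = (K * A') * (K * B') := by ring
    rw [htwo, hZZ, hAA, hBB] at h1
    have e1 : q ^ m * (Z - A - B + AB) * (q ^ m * Z) - q ^ m * (Z - A) * (q ^ m * (Z - B)) =
        q ^ m * q ^ m * (AB * Z) - q ^ m * q ^ m * (A * B) := by ring
    have h2 : q ^ m * q ^ m * (AB * Z) ≤ q ^ m * q ^ m * (A * B) := by
      have h3 : q ^ m * (Z - A - B + AB) * (q ^ m * Z) - q ^ m * (Z - A) * (q ^ m * (Z - B)) ≤ 0 := by linarith [h1]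
      rw [e1] at h3
      linarith [h3]
    exact le_of_mul_le_mul_left h2 (mul_pos hqm hqm)
  rw [div_mul_div_comm, div_le_div_iff₀ hZpos (mul_pos hZpos hZpos)]
  nlinarith [hmain, hZpos]

omit [Fintype V] [Fintype V'] in
/-- **Dual weights exist**: for `0 < q` there is a weight vector on `V'`, supported on the listing `e'`, with
`w'(e' i)·(w(e i) + q(1 − w(e i))) = q(1 − w(e i))`, i.e. `w'/(1 − w') = q(1 − w)/w` (Grimmett's `p_d`).
[cite: Grimmett2006, §6.1 eq. (6.5) (p. 134)] -/
theorem exists_dual_weights (he' : Function.Injective e') (hq : 0 < q) (w : Sym2 V → unitInterval) :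
    ∃ w' : Sym2 V' → unitInterval, (∀ f, ((w' f : unitInterval) : ℝ) ≠ 0 → f ∈ Set.range e') ∧
      ∀ i, ((w' (e' i) : unitInterval) : ℝ) * (((w (e i) : unitInterval) : ℝ) + q * (1 - w (e i))) = q * (1 - w (e i)) := by
  have hD : ∀ i, 0 < ((w (e i) : unitInterval) : ℝ) + q * (1 - w (e i)) := fun i => dualDen_pos hq i
  have hnum : ∀ i, 0 ≤ q * (1 - ((w (e i) : unitInterval) : ℝ)) := fun i => mul_nonneg hq.le (sub_nonneg.2 (w (e i)).2.2)
  let p' : Fin m → unitInterval := fun i =>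
    ⟨q * (1 - ((w (e i) : unitInterval) : ℝ)) / (((w (e i) : unitInterval) : ℝ) + q * (1 - w (e i))),
      div_nonneg (hnum i) (hD i).le, div_le_one_of_le₀ (by linarith [(w (e i)).2.1]) (hD i).le⟩
  refine ⟨fun f => if h : ∃ i, e' i = f then p' (Classical.choose h) else 0, ?_, ?_⟩
  · intro f hf
    by_contra hnot
    exact hf (by dsimp only; rw [dif_neg (fun ⟨i, hi⟩ => hnot ⟨i, hi⟩)]; rfl)
  · intro i
    have h : ∃ j, e' j = e' i := ⟨i, rfl⟩
    dsimp only
    rw [dif_pos h, show Classical.choose h = i from he' (Classical.choose_spec h)]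
    change q * (1 - ((w (e i) : unitInterval) : ℝ)) / (((w (e i) : unitInterval) : ℝ) + q * (1 - w (e i))) * _ = _
    rw [div_mul_cancel₀ _ (hD i).ne']

/-- A pair of weight `0` is a.s. closed, hence negatively correlated with every pair. [cite: Grimmett2006, §1.4 eq. (1.20) (p. 15)] -/
theorem negCorr_of_weight_zero (w : Sym2 V → unitInterval) (hq : 0 < q) {f : Sym2 V} (g : Sym2 V)
    (hf : ((w f : unitInterval) : ℝ) = 0) :
    (rcMeasureW w q ∅).real ({ω : BondConfig V | f ∈ ω} ∩ {ω | g ∈ ω}) ≤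
      (rcMeasureW w q ∅).real {ω : BondConfig V | f ∈ ω} * (rcMeasureW w q ∅).real {ω : BondConfig V | g ∈ ω} := by
  have hzero : ∀ X : Set (BondConfig V), X ⊆ {ω : BondConfig V | f ∈ ω} → (rcMeasureW w q ∅).real X = 0 := by
    intro X hX
    rw [rcMeasureW_real_eq_sum_div w hq ∅ X, Finset.sum_eq_zero, zero_div]
    intro ω _
    by_cases hω : ω ∈ X
    · have hfω : f ∈ ω := hX hω
      unfold rcWeightW weight
      rw [Finset.prod_eq_zero (Finset.mem_univ f) (by dsimp only; rw [if_pos hfω, hf]), zero_mul, zero_mul]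
    · rw [ind_of_not_mem hω, mul_zero]
  rw [hzero _ Set.inter_subset_left, hzero _ subset_rfl, zero_mul]

/-- **Potts–Rayleigh supports are closed under abstract duality** (`0 < q`): if the loop-free listing `e'` on `V'` and the
listing `e` on `V` are abstractly dual with constant `c` — `k_V(e '' t) + |t| = k_{V'}(e' '' tᶜ) + c` for every `t`, e.g. a
plane graph and its geometric dual by Euler's formula — and every weight vector supported on `e'` gives an edge-negatively
associated `φ_{·,q}`, then so does every weight vector supported on `e`.  Graph case of Wagner 2008, Thm. 5.8 (duals of
Potts–Rayleigh matroids), via Grimmett 2006, §6.1 (6.1)–(6.6). [cite: Wagner2006, Thm. 5.8, §5.3 (pp. 14–15)]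
[cite: Grimmett2006, §6.1 eq. (6.1)–(6.6) (pp. 133–134); §3.9 eq. (3.94) (p. 63)] -/
theorem edgeNegCorrSupp_of_dual (he : Function.Injective e) (he' : Function.Injective e') (hdiag' : ∀ i, ¬ (e' i).IsDiag)
    (hq : 0 < q) (c : ℕ)
    (hk : ∀ t : Finset (Fin m), clusterCount ((↑(t.image e) : BondConfig V)) ∅ + t.card =
      clusterCount ((↑(tᶜ.image e') : BondConfig V')) ∅ + c)
    (h' : EdgeNegCorrSupp (Set.range e') q) : EdgeNegCorrSupp (Set.range e) q := by
  intro w hw e₀ f _ hfe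
  by_cases hw0 : ((w e₀ : unitInterval) : ℝ) = 0
  · exact negCorr_of_weight_zero w hq f hw0
  by_cases hwf : ((w f : unitInterval) : ℝ) = 0
  · rw [Set.inter_comm, mul_comm]
    exact negCorr_of_weight_zero w hq e₀ hwf
  obtain ⟨i, rfl⟩ := hw e₀ hw0
  obtain ⟨j, rfl⟩ := hw f hwf
  have hij : i ≠ j := fun h => hfe (h ▸ rfl)
  obtain ⟨w', hw', hdual⟩ := exists_dual_weights (e := e) he' hq w
  exact negCorr_dual he he' hw hw' hq hdual hk i j (h' w' hw' (e' i) (e' j) (hdiag' i) (fun h => hij (he' h).symm))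

end Dual

end FK

end Summit.CriticalPhenomena.PercolationContinuityZ3.Theorems

end
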